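/-
# Solo-blind programme on Kontsevich–Zagier, s6 part T4d: the five-term relation — assembly

Last step of the five-term relation inside KZ's rules (`SoloBlindFiveTermWedge`, `…Xi`, `…Mid`).
The rational chart

  `Θ(t₀, t₁) = (y(1−t₁)/(1−y t₀), y(1−t₀)/(1−y t₀))`   (`|Jacobian| = y²(1−y)/(1−y t₀)³`)

maps the wedge `V = {y t₀ < t₁ < t₀ < x}` onto the upper triangle `T = {y ⋆ x < t₁ < t₀ < y}` of
`D(y)` and pulls the dilogarithm form back to `θ = y dt/((1−y t₀)(1−t₁))` (rule 2:
`[V, θ] = [T]`).  With the three previous files this proves, for all real algebraic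
`0 < x, y < 1`, the **five-term relation as an identity of KZ classes**

  `[D(x)] + [D(y)] − [D(xy)] − [D(x ⋆ y)] − [D(y ⋆ x)] = ℓ((1−xy)/(1−x)) · ℓ((1−xy)/(1−y))`

(`five_term`; `x ⋆ y = x(1−y)/(1−xy)`), i.e. Abel's identity
`Li₂(x) + Li₂(y) − Li₂(xy) − Li₂(x ⋆ y) − Li₂(y ⋆ x) = log((1−x)/(1−xy))·log((1−y)/(1−xy))`
holds move-by-move: four charts, three dissections, one integrand split — and no Stokes move.
-/
import Summits.KontsevichZagierPeriods.KontsevichZagierPeriods.Theorems.SoloBlindFiveTermMid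
import Summits.KontsevichZagierPeriods.KontsevichZagierPeriods.Theorems.SoloBlindGoldenDilog

noncomputable section

open MeasureTheory Set MvPolynomial
open Literature.NumberTheory.Transcendental
open Literature.NumberTheory.Transcendental.KZ
open Literature.NumberTheory.Transcendental.KZ.IntegralRep
open Literature.ModelTheory.ExponentialFields (IsSemialgebraic isSemialgebraic_setOf_eval_pos)
open scoped goldenRatio

namespace Summit.KontsevichZagierPeriods.KontsevichZagierPeriods.Theorems

namespace SoloBlind

variable (a c : Cut)

/-! ## Move (2): the chart `Θ` maps the wedge `V` onto `T` -/

/-- `d/dr [y(1−r)/(1−yr)] = y(y−1)/(1−yr)²`. -/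
theorem hasDerivAt_coTwistCoord {y r : ℝ} (hr : 1 - y * r ≠ 0) :
    HasDerivAt (fun r : ℝ => y * (1 - r) * (1 - y * r)⁻¹)
      (y * (y - 1) * ((1 - y * r) ^ 2)⁻¹) r := by
  have h1 : HasDerivAt (fun r : ℝ => 1 - y * r) (-y) r := by
    simpa using ((hasDerivAt_id' r).const_mul y).const_sub 1
  have h2 : HasDerivAt (fun s : ℝ => y * (1 - s) * (1 - y * s)⁻¹)
      (y * -1 * (1 - y * r)⁻¹ + y * (1 - r) * (-(-y) / (1 - y * r) ^ 2)) r :=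
    (((hasDerivAt_id' r).const_sub 1).const_mul y).mul (h1.inv hr)
  refine h2.congr_deriv ?_
  field_simp
  ring

/-- `Θ(t₀, t₁) = (y(1−t₁)/(1−y t₀), y(1−t₀)/(1−y t₀))`. -/
def thetaChart (p : Fin 2 → ℝ) : Fin 2 → ℝ :=
  ![c.x * (1 - p 1) * (1 - c.x * p 0)⁻¹, c.x * (1 - p 0) * (1 - c.x * p 0)⁻¹]

/-- `DΘ(t)`. -/
def thetaDeriv (p : Fin 2 → ℝ) : (Fin 2 → ℝ) →L[ℝ] (Fin 2 → ℝ) :=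
  ContinuousLinearMap.pi ![(c.x ^ 2 * (1 - p 1) * ((1 - c.x * p 0) ^ 2)⁻¹) • pr2 0 +
      (-(c.x * (1 - c.x * p 0)⁻¹)) • pr2 1,
    (c.x * (c.x - 1) * ((1 - c.x * p 0) ^ 2)⁻¹) • pr2 0]

/-- `Θ` has the stated derivative off `{1 − y t₀ = 0}`. -/
theorem hasFDerivAt_thetaChart {p : Fin 2 → ℝ} (hp : 1 - c.x * p 0 ≠ 0) :
    HasFDerivAt (thetaChart c) (thetaDeriv c p) p := by
  have hπ0 : HasFDerivAt (fun q : Fin 2 → ℝ => q 0) (pr2 0) p := hasFDerivAt_apply 0 p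
  have hπ1 : HasFDerivAt (fun q : Fin 2 → ℝ => q 1) (pr2 1) p := hasFDerivAt_apply 1 p
  rw [hasFDerivAt_pi']
  refine Fin.forall_fin_two.mpr ⟨?_, ?_⟩
  · have hfun : (fun q : Fin 2 → ℝ => thetaChart c q 0) =
        fun q => c.x * (1 - q 1) * (1 - c.x * q 0)⁻¹ := by
      funext q; simp [thetaChart]
    rw [hfun]
    have hA : HasFDerivAt (fun q : Fin 2 → ℝ => c.x * (1 - q 1)) (c.x • -pr2 1) p :=
      (hπ1.const_sub 1).const_mul c.x
    have hB := (hasDerivAt_inv_twistDen hp).hasFDerivAt.comp p hπ0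
    refine (hA.mul hB).congr_fderiv (ContinuousLinearMap.ext fun v => ?_)
    simp [thetaDeriv]
    ring
  · have hfun : (fun q : Fin 2 → ℝ => thetaChart c q 1) =
        fun q => c.x * (1 - q 0) * (1 - c.x * q 0)⁻¹ := by
      funext q; simp [thetaChart]
    rw [hfun]
    have h := (hasDerivAt_coTwistCoord hp).hasFDerivAt.comp p hπ0
    refine h.congr_fderiv (ContinuousLinearMap.ext fun v => ?_)
    simp [thetaDeriv]
    ring

/-- The matrix of `DΘ(t)`. -/
theorem toMatrix_thetaDeriv (p : Fin 2 → ℝ) :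
    LinearMap.toMatrix' ((thetaDeriv c p : (Fin 2 → ℝ) →L[ℝ] (Fin 2 → ℝ)) :
      (Fin 2 → ℝ) →ₗ[ℝ] (Fin 2 → ℝ)) =
      !![c.x ^ 2 * (1 - p 1) * ((1 - c.x * p 0) ^ 2)⁻¹, -(c.x * (1 - c.x * p 0)⁻¹);
        c.x * (c.x - 1) * ((1 - c.x * p 0) ^ 2)⁻¹, 0] := by
  ext i j
  rw [LinearMap.toMatrix'_apply, ContinuousLinearMap.coe_coe]
  fin_cases i <;> fin_cases j <;> simp [thetaDeriv]

/-- `|det DΘ(t)| = y²(1−y)/(1−y t₀)³`. -/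
theorem abs_det_thetaDeriv {p : Fin 2 → ℝ} (hp : 0 < 1 - c.x * p 0) :
    |(thetaDeriv c p).det| = c.x ^ 2 * (1 - c.x) * ((1 - c.x * p 0) ^ 3)⁻¹ := by
  rw [ContinuousLinearMap.det, ← LinearMap.det_toMatrix', toMatrix_thetaDeriv,
    Matrix.det_fin_two_of]
  have hd := hp.ne'
  have e : c.x ^ 2 * (1 - p 1) * ((1 - c.x * p 0) ^ 2)⁻¹ * 0 -
      -(c.x * (1 - c.x * p 0)⁻¹) * (c.x * (c.x - 1) * ((1 - c.x * p 0) ^ 2)⁻¹) =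
        -(c.x ^ 2 * (1 - c.x) * ((1 - c.x * p 0) ^ 3)⁻¹) := by
    field_simp
    ring
  rw [e, abs_neg]
  exact abs_of_pos (mul_pos (mul_pos (pow_pos c.pos 2) c.symm_pos) (inv_pos.2 (pow_pos hp 3)))

/-- `Θ` is injective on the wedge. -/
theorem injOn_thetaChart : InjOn (thetaChart c) (ftWedgeDom a c) := by
  intro p hp p' hp' h
  have hd := (twistDen_pos_of_mem a c hp).ne'
  have hd' := (twistDen_pos_of_mem a c hp').ne'
  have hy := c.pos.ne'
  have hy1 := c.symm_pos.ne'
  have h0 := congrFun h 0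
  have h1 := congrFun h 1
  simp only [thetaChart, Matrix.cons_val_zero, Matrix.cons_val_one] at h0 h1
  have e0 : p 0 = p' 0 := by
    rw [← div_eq_mul_inv, ← div_eq_mul_inv, div_eq_div_iff hd hd'] at h1
    have h2 : c.x * (1 - c.x) * (p' 0 - p 0) = 0 := by linear_combination h1
    rcases mul_eq_zero.1 h2 with h3 | h3
    · exact absurd h3 (mul_ne_zero hy hy1)
    · linarith
  rw [e0, ← div_eq_mul_inv, ← div_eq_mul_inv, div_left_inj' hd'] at h0
  have h3 := mul_left_cancel₀ hy h0
  funext i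
  fin_cases i
  · exact e0
  · show p 1 = p' 1
    linarith

/-- `Θ(V) = T`. -/
theorem image_thetaChart : thetaChart c '' ftWedgeDom a c = hiDom a c := by
  have hy := c.pos
  have hy1 := c.lt_one
  have hf := Cut.twist_x c a
  ext u
  simp only [mem_image, ftWedgeDom, hiDom, mem_setOf_eq]
  constructor
  · rintro ⟨p, hp, rfl⟩
    have hd := twistDen_pos_of_mem a c hp
    obtain ⟨h0, h1, h2, h3⟩ := hp
    simp only [thetaChart, Matrix.cons_val_zero, Matrix.cons_val_one]
    refine ⟨?_, ?_, ?_⟩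
    · rw [hf, ← div_eq_mul_inv, ← div_eq_mul_inv, div_lt_div_iff₀ (c.twistDen_pos a) hd]
      nlinarith [mul_pos (mul_pos hy (sub_pos.2 h3)) c.symm_pos]
    · rw [mul_lt_mul_iff_of_pos_right (inv_pos.2 hd)]
      nlinarith [mul_pos hy (sub_pos.2 h2)]
    · rw [mul_inv_lt_iff₀ hd]
      nlinarith [mul_pos hy (sub_pos.2 h1)]
  · rintro ⟨h1, h2, h3⟩
    have hu1 : u 1 < 1 := by linarith
    have hy0 : c.x ≠ 0 := hy.ne'
    have hu1' : 1 - u 1 ≠ 0 := (sub_pos.2 hu1).ne'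
    have hy1' : 1 - c.x ≠ 0 := c.symm_pos.ne'
    set K : ℝ := (1 - c.x) * (1 - u 1)⁻¹ with hK
    have hK0 : 0 < K := mul_pos c.symm_pos (inv_pos.2 (sub_pos.2 hu1))
    have hKne : K ≠ 0 := hK0.ne'
    set x : ℝ := (c.x - u 1) * (c.x * (1 - u 1))⁻¹ with hx
    have hx0 : 0 < x := mul_pos (by linarith) (inv_pos.2 (mul_pos hy (sub_pos.2 hu1)))
    have hdx : 1 - c.x * x = K := by
      rw [hx, hK]
      field_simp
      ring
    have hd : 0 < 1 - c.x * x := by rw [hdx]; exact hK0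
    have e1 : c.x * (1 - x) * (1 - c.x * x)⁻¹ = u 1 := by
      rw [hdx, hx, hK]
      field_simp
      ring
    have hxa : x < a.x := by
      -- `x ↦ y(1−x)/(1−yx)` is decreasing and `u 1 > f`, its value at `a.x`
      by_contra hle
      rw [not_lt] at hle
      have hmono : c.x * (1 - x) * (1 - c.x * x)⁻¹ ≤ c.x * (1 - a.x) * (1 - a.x * c.x)⁻¹ := by
        rw [← div_eq_mul_inv, ← div_eq_mul_inv, div_le_div_iff₀ hd (c.twistDen_pos a)]
        nlinarith [mul_nonneg (mul_nonneg hy.le (sub_nonneg.2 hle)) c.symm_pos.le]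
      rw [e1, ← hf] at hmono
      exact absurd h1 (not_lt.2 hmono)
    refine ⟨![x, 1 - u 0 * K * c.x⁻¹], ⟨hx0, ?_, ?_, hxa⟩, ?_⟩
    · show c.x * x < 1 - u 0 * K * c.x⁻¹
      have e2 : c.x * x = 1 - K := by linarith [hdx]
      have h4 : u 0 * K * c.x⁻¹ < K := by
        calc u 0 * K * c.x⁻¹ = u 0 * c.x⁻¹ * K := by ring
          _ < 1 * K := mul_lt_mul_of_pos_right (by rwa [mul_inv_lt_iff₀ hy, one_mul]) hK0
          _ = K := one_mul K
      linarith
    · show 1 - u 0 * K * c.x⁻¹ < x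
      have e3 : x = 1 - u 1 * K * c.x⁻¹ := by
        rw [hx, hK]
        field_simp
        ring
      rw [e3]
      have h5 : u 1 * K * c.x⁻¹ < u 0 * K * c.x⁻¹ :=
        mul_lt_mul_of_pos_right (mul_lt_mul_of_pos_right h2 hK0) (inv_pos.2 hy)
      linarith
    · funext i
      fin_cases i
      · show c.x * (1 - (1 - u 0 * K * c.x⁻¹)) * (1 - c.x * x)⁻¹ = u 0
        rw [hdx, sub_sub_cancel]
        field_simp
      · exact e1

/-- `Θ` is `ℚ`-semialgebraic. -/
theorem isSemialgebraicMapOn_thetaChart :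
    IsSemialgebraicMapOn ℚ (ftWedgeDom a c) (thetaChart c) := by
  have hS := isSemialgebraic_ftWedgeDom a c
  have hne : ∀ p ∈ ftWedgeDom a c, 1 - c.x * p 0 ≠ 0 :=
    fun p hp => (twistDen_pos_of_mem a c hp).ne'
  refine IsSemialgebraicMapOn.of_forall hS fun i => ?_
  fin_cases i
  · exact ((IsSemialgebraicFunOn.mul_holds (isSemialgebraicFunOn_const_of_isAlgebraic hS c.alg)
      (isSemialgebraicFunOn_aeval hS (1 - X 1))).div (isSemialgebraicFunOn_twistDen a c)
        hne).congr fun p _ => by simp [thetaChart, div_eq_mul_inv]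
  · exact ((IsSemialgebraicFunOn.mul_holds (isSemialgebraicFunOn_const_of_isAlgebraic hS c.alg)
      (isSemialgebraicFunOn_aeval hS (1 - X 0))).div (isSemialgebraicFunOn_twistDen a c)
        hne).congr fun p _ => by simp [thetaChart, div_eq_mul_inv]

/-- On the wedge: `θ = (dilogFun ∘ Θ) · |det DΘ|`. -/
theorem thetaFun_eq {p : Fin 2 → ℝ} (hp : p ∈ ftWedgeDom a c) :
    thetaFun c p = dilogFun (thetaChart c p) * (c.x ^ 2 * (1 - c.x) * ((1 - c.x * p 0) ^ 3)⁻¹) := by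
  obtain ⟨hp0, hp1, hd⟩ := wedge_ne_zero a c hp
  have hy : c.x ≠ 0 := c.pos.ne'
  have hy1 : 1 - c.x ≠ 0 := c.symm_pos.ne'
  have hd' : 1 - p 0 * c.x ≠ 0 := by rwa [mul_comm] at hd
  have h2 : 1 - c.x * (1 - p 0) * (1 - c.x * p 0)⁻¹ = (1 - c.x) * (1 - c.x * p 0)⁻¹ := by
    field_simp
    ring
  simp only [thetaFun, dilogFun, thetaChart, Matrix.cons_val_zero, Matrix.cons_val_one]
  rw [h2]
  field_simp

/-- **Chart move.** `[V, θ] ≡ [T]`. -/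
theorem thetaRep_equiv_hiRep : Equivalent (thetaRep a c) (hiRep a c) :=
  equivalent_of_chart (isSemialgebraicMapOn_thetaChart a c)
    (fun _ hp => hasFDerivAt_thetaChart c (twistDen_pos_of_mem a c hp).ne')
    (injOn_thetaChart a c) (image_thetaChart a c)
    (J := fun p => c.x ^ 2 * (1 - c.x) * ((1 - c.x * p 0) ^ 3)⁻¹)
    (fun _ hp => abs_det_thetaDeriv c (twistDen_pos_of_mem a c hp))
    (fun _ hp => thetaFun_eq a c hp) rfl (fun _ _ => rfl) rfl (fun _ _ => rfl)

/-- **`[D(y)] = [D(y ⋆ x)] + ℓ(y/f)·ℓ(1/(1−f)) + [V, θ]`** in `Q` (`f = y ⋆ x`). -/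
theorem mkQ_dilogCut_eq_twist : mkQ (of (dilogCut c)) = mkQ (of (dilogCut (c.twist a))) +
    ell ((c.twist a).x⁻¹ * c.x) * ell ((1 - (c.twist a).x)⁻¹) + mkQ (of (thetaRep a c)) := by
  rw [← mkQ_midRep, mkQ_eq_mkQ_iff.2 (thetaRep_equiv_hiRep a c), ← map_add, ← map_add,
    mkQ_eq_mkQ_iff]
  have e : of (dilogCut c) - (of (dilogCut (c.twist a)) + of (midRep a c) + of (hiRep a c)) =
      of (dilogCut c) - of (dilogCut (c.twist a)) - of (midRep a c) - of (hiRep a c) := by abel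
  rw [e]
  exact dilogCut_dissect_twist a c

/-! ## The five-term relation -/

/-- **The five-term relation of the dilogarithm inside KZ's rules.**  For algebraic cuts `x, y`:
`[D(x)] + [D(y)] − [D(xy)] − [D(x ⋆ y)] − [D(y ⋆ x)] = ℓ(y/(y ⋆ x)) · ℓ(1/(1 − y ⋆ x))`,
where `y/(y ⋆ x) = (1−xy)/(1−x)` and `1/(1 − y ⋆ x) = (1−xy)/(1−y)`. -/
theorem five_term : mkQ (of (dilogCut a)) + mkQ (of (dilogCut c)) - mkQ (of (dilogCut (a.mul c))) -
    mkQ (of (dilogCut (a.twist c))) - mkQ (of (dilogCut (c.twist a))) =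
      ell ((c.twist a).x⁻¹ * c.x) * ell ((1 - (c.twist a).x)⁻¹) := by
  have h1 := mkQ_thetaRep a c
  have h2 := mkQ_dilogCut_eq_twist a c
  linear_combination h2 + h1

/-- The two logarithmic arguments, in closed form. -/
theorem five_term_args : (c.twist a).x⁻¹ * c.x = (1 - a.x * c.x) * (1 - a.x)⁻¹ ∧
    (1 - (c.twist a).x)⁻¹ = (1 - a.x * c.x) * (1 - c.x)⁻¹ := by
  have hx := a.symm_pos.ne'
  have hy := c.pos.ne'
  have hy1 := c.symm_pos.ne'
  have hd := (c.twistDen_pos a).ne'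
  have hd' : 1 - c.x * a.x ≠ 0 := by rwa [mul_comm] at hd
  refine ⟨?_, ?_⟩
  · rw [Cut.twist_x]
    field_simp
  · have e : 1 - (c.twist a).x = (1 - c.x) * (1 - a.x * c.x)⁻¹ := by
      rw [Cut.twist_x]
      field_simp
      ring
    rw [e, mul_inv, inv_inv, mul_comm]

/-- **Period shadow.**  `Li₂(x) + Li₂(y) − Li₂(xy) − Li₂(x ⋆ y) − Li₂(y ⋆ x)
  = log((1−xy)/(1−x)) · log((1−xy)/(1−y))` as real numbers, read off through `evalQ`. -/
theorem five_term_value : (dilogCut a).value + (dilogCut c).value - (dilogCut (a.mul c)).value -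
    (dilogCut (a.twist c)).value - (dilogCut (c.twist a)).value =
      Real.log ((1 - a.x * c.x) * (1 - a.x)⁻¹) * Real.log ((1 - a.x * c.x) * (1 - c.x)⁻¹) := by
  have h := congrArg evalQ (five_term a c)
  obtain ⟨e1, e2⟩ := five_term_args a c
  have hA : 1 ≤ (c.twist a).x⁻¹ * c.x := by
    rw [le_inv_mul_iff₀ (c.twist a).pos, mul_one]
    exact (Cut.twist_lt a c).le
  have hB : 1 ≤ (1 - (c.twist a).x)⁻¹ := (c.twist a).symm.one_lt_inv.le
  have l1 : evalQ (ell ((c.twist a).x⁻¹ * c.x)) = Real.log ((c.twist a).x⁻¹ * c.x) :=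
    evalQ_ell ((c.twist a).alg_inv.mul c.alg) hA
  have l2 : evalQ (ell (1 - (c.twist a).x)⁻¹) = Real.log (1 - (c.twist a).x)⁻¹ :=
    evalQ_ell (c.twist a).symm.alg_inv hB
  rw [map_sub, map_sub, map_sub, map_add, map_mul, evalQ_mkQ, evalQ_mkQ, evalQ_mkQ, evalQ_mkQ,
    evalQ_mkQ, eval_of, eval_of, eval_of, eval_of, eval_of, l1, l2, e1, e2] at h
  exact h

/-! ## The golden point: `x = y = 1/φ` is a fixed point of `(x, y) ↦ (xy, x ⋆ y)` -/

/-- `(1/φ)·(1/φ) = 1/φ²` as cuts. -/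
theorem goldCut₁_mul_self : goldCut₁.mul goldCut₁ = goldCut₂ :=
  Cut.ext (by rw [Cut.mul_x, goldCut₁_x, goldCut₂_x, ← pow_two, goldenRatio_sub_one_sq])

/-- `(1/φ) ⋆ (1/φ) = 1/φ²` as cuts: the golden section is self-twisting. -/
theorem goldCut₁_twist_self : goldCut₁.twist goldCut₁ = goldCut₂ :=
  Cut.ext (by
    have h0 : φ - 1 ≠ 0 := goldCut₁.pos.ne'
    have h1 : (φ - 1) * (φ - 1) = 2 - φ := by rw [← pow_two, goldenRatio_sub_one_sq]
    rw [Cut.twist_x, goldCut₁_x, goldCut₂_x, h1, show 1 - (2 - φ) = φ - 1 by ring,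
      show 1 - (φ - 1) = 2 - φ by ring, mul_assoc, mul_comm (2 - φ), ← mul_assoc,
      mul_inv_cancel₀ h0, one_mul])

/-- **The five-term relation at the golden point:** `2[D(1/φ)] − 3[D(1/φ²)] = ℓ(φ)²`, i.e.
`2 Li₂(1/φ) − 3 Li₂(1/φ²) = log² φ` — consistent with (and independent of) Landen's evaluations
`[D(1/φ)] = [Λ₂]·(6/10) − ℓ(φ)²`, `[D(1/φ²)] = [Λ₂]·(6/15) − ℓ(φ)²` of `SoloBlindGoldenDilog`;
together with Euler's reflection at `1/φ² = 1 − 1/φ` it re-derives them. -/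
theorem five_term_gold : 2 * mkQ (of dilogGoldOne) - 3 * mkQ (of dilogGoldTwo) = ell φ ^ 2 := by
  have h := five_term goldCut₁ goldCut₁
  have e3 : (2 - φ)⁻¹ * (φ - 1) = φ := by
    rw [inv_two_sub_goldenRatio, pow_two, mul_assoc, goldenRatio_mul_sub_one, mul_one]
  have e4 : (1 - (2 - φ))⁻¹ = φ := by
    rw [show 1 - (2 - φ) = φ - 1 by ring]
    exact inv_goldenRatio_sub_one
  rw [goldCut₁_mul_self, goldCut₁_twist_self, goldCut₂_x, goldCut₁_x, e3, e4, ← pow_two] at h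
  linear_combination h

end SoloBlind

end Summit.KontsevichZagierPeriods.KontsevichZagierPeriods.Theorems
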